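import Summits.Ventures.QEC.Census.Calib.CalibRows01
import Literature.InformationTheory.QuantumCodes.QuantumHammingDecoder
import Literature.InformationTheory.QuantumCodes.CSSDecoderReindex
import Literature.InformationTheory.QuantumCodes.CSSEquivalence
import Literature.InformationTheory.QuantumCodes.OptimalRadius
import HarnessLib

/-!
# Census calibration row `cal_Steane7` IS the quantum Hamming code `QH_3` (same numbering): `⟦7,1,3⟧` by the family theorem
# and its EXPLICIT syndrome decoder with certified radius `1`

LADDER-QEC (venture cell `qec`), PARTITION row 08 (Summits link of two Literature family files to the census):
`QuantumHammingCodes.lean` (`QuantumHamming.code r hr = CSS(H_r, H_r)`, `steane_isCode : (code 3 _).IsCode 7 1 3`) and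
`QuantumHammingDecoder.lean` (item 134: the Hamming syndrome decoder `QuantumHamming.decodeX / decodeZ`, radius `1` for every
`r`). The calibration row `cal_Steane7` (Census/Calib/CalibRows01.lean, qec-search-7's emitter; certificate `f6025bbc84a0f4ae`;
KERNEL-std already by `cal_Steane7.isCode`) has check rows `{0,2,4,6}, {1,2,5,6}, {3,4,5,6}` for BOTH `H_X` and `H_Z` — which is
EXACTLY the Hamming matrix `H_3` (column `i` = binary digits of `i + 1`, least significant digit = row `0`). Hence, with the
identity numbering of qubits and checks (`Fin.cast`):

* `HX_eq_submatrix` / `HZ_eq_submatrix` (`decide +kernel`), `eq_reindex_hamming` (FACT P), `isCode_iff_hamming` (so the row's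
  landed `cal_Steane7.isCode : … IsCode 7 1 3` is ALSO `QuantumHamming.steane_isCode` transported — not restated here, dedup);
* ★ `decodeX_correctsUpTo` / `decodeZ_correctsUpTo` — the census object INHERITS the explicit Hamming/Steane syndrome decoder
  (transported by `Decoder.reindexX/Z`, `CSSDecoderReindex.lean`): it corrects every single bit flip and every single phase flip of
  `cal_Steane7.cert.code`, a computable decoder with certified radius `1` = the optimal one (the row's radius entry
  `cal_Steane7.hasOptimalRadius` is already in `Decoders/CensusOptimalRadiusMix13.lean`).

Tier KERNEL-std (`decide` / `decide +kernel` on 7-qubit tables only; axioms standard). HONEST FRAMING: calibration code; the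
certificate of record stays the row's census evidence; no novelty.

References: [Steane1996Simple, §3 (p0006 L55–58: the [[7,1,3]] code)]; [MacWilliamsSloane1977, Ch. 1 §7 (p0030: H_3)];
[LinPryadko2024, §4.2 Thm 6 (FACT P)]; [NielsenChuang2010, §10.4.2 (p. 450: the Steane code corrects one bit and one phase flip)].
-/

namespace Summit.Ventures.QEC.Census

open Matrix Literature.InformationTheory.QuantumCodes Literature.InformationTheory.Coding

namespace cal_Steane7

/-- The qubit numbering is the identity (`Fin cert.n = Fin 7 → Fin (2^3 − 1)`). (definition) [cite: Steane1996Simple, §3 (p0006 L55-58)] -/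
def σ (q : Fin cal_Steane7.cert.n) : Fin (2 ^ 3 - 1) := ⟨q.val % 7, Nat.mod_lt _ (by decide)⟩

/-- The `X`-check numbering is the identity. (definition) [cite: MacWilliamsSloane1977, Ch. 1 §7 (p0030)] -/
def ρX (r : Fin cal_Steane7.cert.HX.length) : Fin 3 := ⟨r.val % 3, Nat.mod_lt _ (by decide)⟩

/-- The `Z`-check numbering is the identity. (definition) [cite: MacWilliamsSloane1977, Ch. 1 §7 (p0030)] -/
def ρZ (r : Fin cal_Steane7.cert.HZ.length) : Fin 3 := ⟨r.val % 3, Nat.mod_lt _ (by decide)⟩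

/-- `σ` is a bijection. [cite: LinPryadko2024, §4.2 Thm 6 (arXiv:2306.16400 p0009 L66-74)] -/
theorem σ_bijective : Function.Bijective σ := by decide

/-- `ρX` is a bijection. [cite: LinPryadko2024, §4.2 Thm 6 (arXiv:2306.16400 p0009 L66-74)] -/
theorem ρX_bijective : Function.Bijective ρX := by decide

/-- `ρZ` is a bijection. [cite: LinPryadko2024, §4.2 Thm 6 (arXiv:2306.16400 p0009 L66-74)] -/
theorem ρZ_bijective : Function.Bijective ρZ := by decide

/-- **The census `X`-check matrix of `cal_Steane7` IS `H_3`** (same numbering). [cite: MacWilliamsSloane1977, Ch. 1 §7 (p0030)] [cite: Steane1996Simple, §3 (p0006 L55-58)] -/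
theorem HX_eq_submatrix :
    (cal_Steane7.cert.code cal_Steane7.commOK_cert).HX
      = (QuantumHamming.code 3 le_rfl).HX.submatrix (Equiv.ofBijective ρX ρX_bijective) (Equiv.ofBijective σ σ_bijective) := by
  show rowMatrix cal_Steane7.cert.n cal_Steane7.cert.HX = _
  decide +kernel

/-- **The census `Z`-check matrix of `cal_Steane7` IS `H_3`** (same numbering). [cite: MacWilliamsSloane1977, Ch. 1 §7 (p0030)] [cite: Steane1996Simple, §3 (p0006 L55-58)] -/
theorem HZ_eq_submatrix :
    (cal_Steane7.cert.code cal_Steane7.commOK_cert).HZ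
      = (QuantumHamming.code 3 le_rfl).HZ.submatrix (Equiv.ofBijective ρZ ρZ_bijective) (Equiv.ofBijective σ σ_bijective) := by
  show rowMatrix cal_Steane7.cert.n cal_Steane7.cert.HZ = _
  decide +kernel

/-- **`cal_Steane7` is a re-indexing of `QH_3`** (FACT P). [cite: LinPryadko2024, §4.2 Thm 6 (arXiv:2306.16400 p0009 L66-74)] -/
theorem eq_reindex_hamming :
    cal_Steane7.cert.code cal_Steane7.commOK_cert
      = (QuantumHamming.code 3 le_rfl).reindex (Equiv.ofBijective ρX ρX_bijective).symm
          (Equiv.ofBijective ρZ ρZ_bijective).symm (Equiv.ofBijective σ σ_bijective).symm :=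
  CSSCode.eq_reindex_of_submatrix HX_eq_submatrix HZ_eq_submatrix

/-- `cal_Steane7` is `[[n,k,d]]` iff `QH_3` is. [cite: LinPryadko2024, §4.2 Thm 6 (arXiv:2306.16400 p0009 L66-91)] -/
theorem isCode_iff_hamming (n k d : ℕ) :
    (cal_Steane7.cert.code cal_Steane7.commOK_cert).IsCode n k d ↔ (QuantumHamming.code 3 le_rfl).IsCode n k d :=
  CSSCode.isCode_iff_of_submatrix HX_eq_submatrix HZ_eq_submatrix n k d

/-- ★ **The census object inherits the Steane/Hamming SYNDROME DECODER for bit flips** (`QuantumHamming.decodeX 3` transported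
by `Decoder.reindexX`): it corrects every single `X`-error of `cal_Steane7.cert.code` — explicit, computable, radius `1`.
[cite: NielsenChuang2010, §10.4.2 (p. 450)] [cite: Steane1996Simple, §3 (p0006 L46)] -/
theorem decodeX_correctsUpTo :
    ((QuantumHamming.decodeX 3).reindexX (Equiv.ofBijective ρZ ρZ_bijective).symm
        (Equiv.ofBijective σ σ_bijective).symm).CorrectsUpTo (cal_Steane7.cert.code cal_Steane7.commOK_cert).xSyndrome
      ((cal_Steane7.cert.code cal_Steane7.commOK_cert).rowSpX : Set (Fin cal_Steane7.cert.n → ZMod 2)) hammingNorm 1 := by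
  rw [eq_reindex_hamming]
  exact (Decoder.reindexX_correctsUpTo_iff _ _ _ _ _ 1).2 (QuantumHamming.decodeX_correctsUpTo le_rfl)

/-- ★ **… and for phase flips** (`QuantumHamming.decodeZ 3` transported): every single `Z`-error of `cal_Steane7.cert.code` is
corrected. [cite: NielsenChuang2010, §10.4.2 (p. 450)] [cite: Steane1996Simple, §3 (p0006 L46)] -/
theorem decodeZ_correctsUpTo :
    ((QuantumHamming.decodeZ 3).reindexZ (Equiv.ofBijective ρX ρX_bijective).symm
        (Equiv.ofBijective σ σ_bijective).symm).CorrectsUpTo (cal_Steane7.cert.code cal_Steane7.commOK_cert).zSyndrome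
      ((cal_Steane7.cert.code cal_Steane7.commOK_cert).rowSpZ : Set (Fin cal_Steane7.cert.n → ZMod 2)) hammingNorm 1 := by
  rw [eq_reindex_hamming]
  exact (Decoder.reindexZ_correctsUpTo_iff _ _ _ _ _ 1).2 (QuantumHamming.decodeZ_correctsUpTo le_rfl)

end cal_Steane7

end Summit.Ventures.QEC.Census
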